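import Mathlib
import HarnessLib
import Summits.HubbardSuperconductivity.HubbardSuperconductivity.Theorems.ComplexGFFStiffnessHypACumulantTunedRepresentation
import Literature.Dynamics.Hyperbolic.RGFlowStableManifoldReducedLipschitz
import Summits.HubbardSuperconductivity.HubbardSuperconductivity.Theorems.ComplexGFFStiffnessHypALocalTwoPointTunedSystemIntegral
import Summits.HubbardSuperconductivity.HubbardSuperconductivity.Theorems.ComplexGFFStiffnessHypALocalTwoPointFreeEnergyPieces

/-!
# Crux `HypALocalTwoPoint`, line `gnv` — the FIRST-DIFFERENCE CLAUSE of `FreeEnergyBounds` at fixed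
# `(L, N)` from the two sizes (census F1 (iii-d))

Route `route-HubbardSuperconductivity-ComplexGFFStiffness`, crux item stmt-HubbardSuperconductivity-19155,
registered stub `stub_twoPointGivenZ` (⇐ `FreeEnergyBounds`, p817758).  The two-system twin of
`…FreeEnergySecondDiff`: composition of `…FreeEnergyRepresentation` (`pertZ = Z₀ · exp f`),
`…FreeEnergyPieces` (`norm_freeEnergyPiece_sub_le`) and `…TunedSystemIntegral` (`I = 1 + Φ(x₀, y_N)`,
`‖I − 1‖ ≤ εη^N A⁻¹A_𝒫`), with the two sizes (`‖x₁ − x₂‖ ≤ T`, last-scale functionals `≤ B`, the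
outputs of `RGFlow.lastScale_sub_le_of_isTunedQ` for the concrete system) as INPUT:

* **`norm_freeEnergy_sub_le_of_sizes`** — `‖f₁ − f₂‖ ≤ |Λ|c_q T + |Λ| T + B/(1−R₀)`.

No `sorry`, no new named fact.

## References
* S. Adams, S. Buchholz, R. Kotecký, S. Müller, arXiv:1910.13564, Theorem 2.2, Ch. 4 (4.7)–(4.12),
  Ch. 12, Lemma 12.6 [AdamsBuchholzKoteckyMuller2019].
-/





noncomputable section

-- `Summit.<Summit>.<Problem>`: single-conjunct summit, the duplicate component is mandated (D-0017).
set_option linter.dupNamespace false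

namespace Summit.HubbardSuperconductivity.HubbardSuperconductivity.Theorems.ComplexGFF

open scoped BigOperators ComplexConjugate
open Real Set Finset MeasureTheory
open Literature.MathematicalPhysics.StatisticalMechanics.GradientRG
open Literature.MathematicalPhysics.StatisticalMechanics.GradientFRD
  (fourierCoeff cExt cExt_of_mem IsElliptic IsUnitSymm InShell iterDiff supNorm conv ellOp isElliptic_one)
open Literature.MathematicalPhysics.StatisticalMechanics.TorusPolymer
  (IsPolymer numBlocks blockOf boxCorner isPolymer_blockOf isConn_blockOf pcirc)
open Literature.Barriers.CriticalPhenomena.LongRangePhi4.Polymer (IsConn components)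
open Literature.MathematicalPhysics.QuantumFieldTheory
open Literature.Dynamics.Hyperbolic

variable {d M : ℕ} [NeZero M]

section Package

variable {L N Mord R n ñ : ℕ} {θbar lam μ δ₁ δ₀ A𝒫 : ℝ}
    {𝒞 : Matrix (Fin d) (Fin d) ℝ → ℕ → (Fin d → ZMod M) → ℝ} {Mc : ℕ → ℝ}
    {Cα : (Fin d → ℕ) → ℕ → ℝ} {c C : ℝ} {Cℓ : ℕ → ℝ}

set_option maxHeartbeats 3200000 in
/-- **First differences of the free energy at fixed `(L, N)` from the two sizes** ([ABKM19] Theorem 2.2,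
`ℓ = 1`, difference form, `ι`-symmetric complex class; census F1 (iii-d)): under the [ABKM19] package
at fixed `(L, N)`, for two tuned seeds `x₁` (system of `𝒦₁`) and `x₂` (system of `𝒦₂`) with
`‖x₁ − x₂‖ ≤ T` and last-scale functionals differing by `≤ B` (the outputs of the two-system size
theorem), the free energies `f_i = log κ_{𝟙,𝟙+q(x_i)} + |Λ|·λ(x_i) + Log I_i` satisfy
`‖f₁ − f₂‖ ≤ |Λ|c_q T + |Λ| T + B/(1−R₀)`, `R₀ = εη^N A⁻¹A_𝒫` (`…FreeEnergyPieces` ∘ `…TunedSystemIntegral`). -/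
theorem norm_freeEnergy_sub_le_of_sizes {h : ℝ} [Fact (0 < h)] [Fact (0 < L)]
    (hd : 3 ≤ d) (hMord : 1 ≤ Mord) (hMR : Mord ≤ R) (hLodd : Odd L) (hL : 2 ^ (d + 3) + 16 * R ≤ L)
    (hR2 : 2 ≤ R) (hM : M = L ^ N)
    (hθbar : 0 < θbar) (hlam : 0 < lam) (hn : 2 * Mord ≤ n) (hn2 : 2 ≤ n) (hnñ : n ≤ ñ)
    (hc : 0 < c) (hC1 : 0 ≤ Cℓ 1)
    (hallA : ∀ A : Matrix (Fin d) (Fin d) ℝ, IsElliptic (1 / 2 : ℝ) 2 A →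
        (∀ k, 1 ≤ k → k ≤ N + 1 →
          ∑ x : Fin d → ZMod M, 𝒞 A k x = 0 ∧ ∀ x, 𝒞 A k (-x) = 𝒞 A k x) ∧
        (∀ k, 1 ≤ k → k ≤ N + 1 → ∀ φ : (Fin d → ZMod M) → ℝ, ∑ x, φ x = 0 →
          0 ≤ ∑ x, ∑ y, φ x * 𝒞 A k (x - y) * φ y) ∧
        (∀ φ : (Fin d → ZMod M) → ℝ, ∑ x, φ x = 0 →
          ellOp A (conv (fun x => ∑ k ∈ Finset.Icc 1 (N + 1), 𝒞 A k x) φ) = φ) ∧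
        (∀ k, 1 ≤ k → k ≤ N → Mc k ≤ 0 ∧
          ∀ x : Fin d → ZMod M, ((L : ℝ) ^ k) / 2 ≤ (supNorm x : ℝ) →
            𝒞 A k x = Mc k) ∧
        (∀ k, 1 ≤ k → k ≤ N + 1 → ∀ B : Matrix (Fin d) (Fin d) ℝ, IsUnitSymm B →
          (∃ ε : ℝ, 0 < ε ∧ ∀ x : Fin d → ZMod M,
            ContDiffOn ℝ ⊤ (fun s : ℝ => 𝒞 (A + s • B) k x) (Set.Ioo (-ε) ε)) ∧
          ∀ α : Fin d → ℕ, ∑ i, α i ≤ n → ∀ ℓ : ℕ, ∀ x : Fin d → ZMod M,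
            abs (iteratedDeriv ℓ (fun s : ℝ => iterDiff α (𝒞 (A + s • B) k) x) 0)
              ≤ Cα α ℓ / (L : ℝ) ^ ((k - 1) * (d - 2 + ∑ i, α i))) ∧
        (∀ k, 1 ≤ k → k ≤ N + 1 → ∀ j : ℕ, ∀ κ : Fin d → ZMod M, κ ≠ 0 → InShell L j κ →
          (j < k →
            c / (L : ℝ) ^ (2 * (d + ñ) + 1) * (L : ℝ) ^ (2 * j)
                / (L : ℝ) ^ ((k - j) * (d - 1 + n)) ≤ (fourierCoeff (𝒞 A k) κ).re ∧
            ‖fourierCoeff (𝒞 A k) κ‖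
              ≤ C * (L : ℝ) ^ (2 * (d + ñ) + 1) * (L : ℝ) ^ (2 * j)
                  / (L : ℝ) ^ ((k - j) * (d - 1 + n))) ∧
          (k ≤ j →
            c / (L : ℝ) ^ (2 * (d + ñ) + 1) * (L : ℝ) ^ (2 * k)
                ≤ (fourierCoeff (𝒞 A k) κ).re ∧
            ‖fourierCoeff (𝒞 A k) κ‖ ≤ C * (L : ℝ) ^ (2 * k)) ∧
          ∀ B : Matrix (Fin d) (Fin d) ℝ, IsUnitSymm B → ∀ ℓ : ℕ, 1 ≤ ℓ →
            (j < k →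
              ‖iteratedDeriv ℓ (fun s : ℝ => fourierCoeff (𝒞 (A + s • B) k) κ) 0‖
                ≤ Cℓ ℓ * (L : ℝ) ^ (2 * (d + ñ) + 1) * (L : ℝ) ^ (2 * j)
                    / (L : ℝ) ^ ((k - j) * (d - 1 + ñ))) ∧
            (k ≤ j →
              ‖iteratedDeriv ℓ (fun s : ℝ => fourierCoeff (𝒞 (A + s • B) k) κ) 0‖
                ≤ Cℓ ℓ * (L : ℝ) ^ (2 * k))))
    (hB : AbkmWeightBounds L N Mord R n θbar lam μ δ₁ δ₀ A𝒫 (fun j => 𝒞 1 j)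
      (abkmWeightData L N Mord R θbar (schedDelta δ₀ δ₁ N) fun j => 𝒞 1 j))
    {pT r₀ : ℕ} (hp : d / 2 + 2 ≤ pT) (hpM : pT + d ≤ Mord) (hr₀ : 3 ≤ r₀)
    (hδ₀ : 0 < δ₀) (hδ₁ : 0 < δ₁) (hh0 : hZeroSq d R δ₀ δ₁ ≤ h ^ 2)
    (hh2 : secondDiffConst (fun θ' => Cα θ' 0) ≤ h ^ 2)
    -- the tuning ball
    {θ : ℝ} (hθ0 : 0 ≤ θ) (hθ : θ < θbar)
    {T₀ : ℝ} (hT₀ : T₀ ≤ 1 / 2) (hKT₀ : shellRatioConst c (Cℓ 1) (L : ℝ) d ñ * T₀ ≤ Real.log (1 + θ))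
    {A𝒫' : ℝ} (hA𝒫' : weightIntConstRho θbar θ (traceConst d Mord R lam (derivSum d n fun θ' _ => Cα θ' 0)) = A𝒫')
    -- the side conditions of Theorem 6.8 (`RGStepABKMQ`), at `A_𝒫' = A_𝒫(θ)`
    {A : ℝ} (hA1 : 1 ≤ A) (hA𝒫A : A𝒫' ≤ A)
    (hsmall : (2 : ℝ) ^ (L ^ d) * (A𝒫' * A ^ (-(1 - (1 + 1 / ((2 * (2 ^ d + 1) + 6 : ℝ) ^ d))⁻¹) : ℝ)) ≤ 1)
    {r : ℝ} (hr : r ≤ 1 / 64)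
    (hv : vABKM d R A A𝒫' r ≤ 1 / 64) (hωA : omegaABKM d R A A𝒫' r * A ^ 2 ≤ 1)
    (hc3A : (kappaABKM d R A A𝒫' r) ^ (L ^ d) * ((2 * (2 * (kappaABKM d R A A𝒫' r) * max 1 A𝒫')) ^ ((2 ^ (d + 1) + 2) ^ d * L ^ d) * (4 : ℝ) ^ ((2 ^ (d + 1) + 2) ^ d * L ^ d)) ≤ A ^ ((1 + 1 / ((2 * (2 ^ d + 1) + 6 : ℝ) ^ d)) - 1 : ℝ))
    (hc2A : (kappaABKM d R A A𝒫' r) ^ (L ^ d) * ((2 * (kappaABKM d R A A𝒫' r) * max 1 A𝒫') ^ ((2 ^ (d + 1) + 2) ^ d * L ^ d) * (2 : ℝ) ^ ((2 ^ (d + 1) + 2) ^ d * L ^ d)) ≤ A ^ ((1 + 1 / ((2 * (2 ^ d + 1) + 6 : ℝ) ^ d)) - 1 : ℝ))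
    {η ε ρ : ℝ} (hη : 0 < η) (hη1 : η ≤ 1) (hε : 0 ≤ ε) (hεr : ε ≤ r) (hερ : ε ≤ ρ) (hρ16 : ρ ≤ 1 / 16)
    (hp4 : 4 * pT ≤ 2 ^ (d + 2))
    (hqT₀ : 2 * (d : ℝ) ^ 2 / (((L ^ (d * 0) : ℕ) : ℝ) * (fieldWt h (L : ℝ) d 0 / (L : ℝ) ^ 0) ^ 2) * ρ ≤ T₀)
    (hqε : 2 * (d : ℝ) ^ 2 / (((L ^ (d * 0) : ℕ) : ℝ) * (fieldWt h (L : ℝ) d 0 / (L : ℝ) ^ 0) ^ 2) * ε ≤ 1 / 2)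
    -- the two perturbations
    {𝒦₁ 𝒦₂ : (Fin d → ℝ) → ℂ} {ρ𝒦 : ℝ} (h𝒦₁ : ContDiff ℝ r₀ 𝒦₁) (h𝒦₂ : ContDiff ℝ r₀ 𝒦₂)
    (h𝒦₁b : ∀ s, s ≤ r₀ → ∀ z : Fin d → ℝ, ‖iteratedFDeriv ℝ s 𝒦₁ z‖ ≤ ρ𝒦 * Real.exp ((∑ i, z i ^ 2) / 4))
    (h𝒦₂b : ∀ s, s ≤ r₀ → ∀ z : Fin d → ℝ, ‖iteratedFDeriv ℝ s 𝒦₂ z‖ ≤ ρ𝒦 * Real.exp ((∑ i, z i ^ 2) / 4))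
    (h𝒦small : (Real.exp (1 / 4) + 2 * Real.exp (3 / 8)) * (ρ𝒦 * Real.exp (fieldWt h (L : ℝ) d 0 / (L : ℝ) ^ 0)) * A ≤ 1 / 2)
    -- the `h`-indexed system (abbreviations fixed by their defining equations)
    (Asys : (fun k => HamSpace ℂ d (fieldWt h (L : ℝ) d k) ((L : ℝ) ^ k) (L ^ (d * k))) 0 → (k : ℕ) → ((fun k => HamSpace ℂ d (fieldWt h (L : ℝ) d k) ((L : ℝ) ^ k) (L ^ (d * k))) k ≃L[ℝ] (fun k => HamSpace ℂ d (fieldWt h (L : ℝ) d k) ((L : ℝ) ^ k) (L ^ (d * k))) (k + 1)))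
    (hAsys : Asys = fun h₀ => rgA L h (fun jj => 𝒞 ((1 : Matrix (Fin d) (Fin d) ℝ) + hamTuningMap ρ h₀) jj))
    (Bsys : (fun k => HamSpace ℂ d (fieldWt h (L : ℝ) d k) ((L : ℝ) ^ k) (L ^ (d * k))) 0 → (k : ℕ) → ((fun k => activitySpace (abkmNormParams L N Mord R pT r₀ h θbar A (schedDelta δ₀ δ₁ N) fun j => 𝒞 1 j) k) k →+ (fun k => HamSpace ℂ d (fieldWt h (L : ℝ) d k) ((L : ℝ) ^ k) (L ^ (d * k))) (k + 1)))
    (hBsys : Eq Bsys fun h₀ =>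
      rgBT hd hMord hMR hLodd hL hM hθbar hlam hn hn2 hnñ hc hC1 hallA hB pT r₀ hr₀ A hθ0 hθ hT₀ hKT₀ (hamTuningMap ρ h₀))
    (Ssys : (fun k => HamSpace ℂ d (fieldWt h (L : ℝ) d k) ((L : ℝ) ^ k) (L ^ (d * k))) 0 → (k : ℕ) → (fun k => HamSpace ℂ d (fieldWt h (L : ℝ) d k) ((L : ℝ) ^ k) (L ^ (d * k))) k → (fun k => activitySpace (abkmNormParams L N Mord R pT r₀ h θbar A (schedDelta δ₀ δ₁ N) fun j => 𝒞 1 j) k) k → (fun k => activitySpace (abkmNormParams L N Mord R pT r₀ h θbar A (schedDelta δ₀ δ₁ N) fun j => 𝒞 1 j) k) (k + 1))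
    (hSsys : Ssys = fun h₀ =>
      rgSQ (L := L) (N := N) (Mord := Mord) (R := R) (p := pT) (r₀ := r₀) (h := h) (θbar := θbar) (A := A)
            (δ₀ := δ₀) (δ₁ := δ₁) (𝒞 := fun j => 𝒞 1 j) (fun jj => 𝒞 ((1 : Matrix (Fin d) (Fin d) ℝ) + hamTuningMap ρ h₀) jj))
    (Φ : (fun k => HamSpace ℂ d (fieldWt h (L : ℝ) d k) ((L : ℝ) ^ k) (L ^ (d * k))) 0 → (fun k => activitySpace (abkmNormParams L N Mord R pT r₀ h θbar A (schedDelta δ₀ δ₁ N) fun j => 𝒞 1 j) k) N → ℂ)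
    (hΦ : Φ = fun h₀ yN =>
      (∫ φ, ((yN : activitySpace (abkmNormParams L N Mord R pT r₀ h θbar A (schedDelta δ₀ δ₁ N) fun j => 𝒞 1 j) N) : Finset (Fin d → ZMod M) → ((Fin d → ZMod M) → ℝ) → ℂ) Finset.univ φ
            ∂(stepMeasure (𝒞 ((1 : Matrix (Fin d) (Fin d) ℝ) + hamTuningMap ρ h₀) (N + 1)))))
    -- two tuned seeds with their trajectories
    (x₁ x₂ : HamSpace ℂ d (fieldWt h (L : ℝ) d 0) ((L : ℝ) ^ 0) (L ^ (d * 0))) (xx₁ xx₂ : ∀ k, HamSpace ℂ d (fieldWt h (L : ℝ) d k) ((L : ℝ) ^ k) (L ^ (d * k)))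
    (htr₁ : RGFlow.IsTunedQ (E := (fun k => HamSpace ℂ d (fieldWt h (L : ℝ) d k) ((L : ℝ) ^ k) (L ^ (d * k)))) (F := (fun k => activitySpace (abkmNormParams L N Mord R pT r₀ h θbar A (schedDelta δ₀ δ₁ N) fun j => 𝒞 1 j) k)) N (Asys x₁) (Bsys x₁) (Ssys x₁)
      (initAct (N := N) (Mord := Mord) (R := R) (p := pT) (r₀ := r₀) (θbar := θbar) (A := A) (δ₀ := δ₀)
            (δ₁ := δ₁) (𝒞 := fun j => 𝒞 1 j) 𝒦₁ x₁) xx₁)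
    (htu₁ : RGFlow.InTubeQ (E := (fun k => HamSpace ℂ d (fieldWt h (L : ℝ) d k) ((L : ℝ) ^ k) (L ^ (d * k)))) (F := (fun k => activitySpace (abkmNormParams L N Mord R pT r₀ h θbar A (schedDelta δ₀ δ₁ N) fun j => 𝒞 1 j) k)) N η ε (activityNormLE (abkmNormParams L N Mord R pT r₀ h θbar A (schedDelta δ₀ δ₁ N) fun j => 𝒞 1 j)) (Ssys x₁)
      (initAct (N := N) (Mord := Mord) (R := R) (p := pT) (r₀ := r₀) (θbar := θbar) (A := A) (δ₀ := δ₀)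
            (δ₁ := δ₁) (𝒞 := fun j => 𝒞 1 j) 𝒦₁ x₁) xx₁)
    (hx₁ : xx₁ 0 = x₁)
    (htr₂ : RGFlow.IsTunedQ (E := (fun k => HamSpace ℂ d (fieldWt h (L : ℝ) d k) ((L : ℝ) ^ k) (L ^ (d * k)))) (F := (fun k => activitySpace (abkmNormParams L N Mord R pT r₀ h θbar A (schedDelta δ₀ δ₁ N) fun j => 𝒞 1 j) k)) N (Asys x₂) (Bsys x₂) (Ssys x₂)
      (initAct (N := N) (Mord := Mord) (R := R) (p := pT) (r₀ := r₀) (θbar := θbar) (A := A) (δ₀ := δ₀)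
            (δ₁ := δ₁) (𝒞 := fun j => 𝒞 1 j) 𝒦₂ x₂) xx₂)
    (htu₂ : RGFlow.InTubeQ (E := (fun k => HamSpace ℂ d (fieldWt h (L : ℝ) d k) ((L : ℝ) ^ k) (L ^ (d * k)))) (F := (fun k => activitySpace (abkmNormParams L N Mord R pT r₀ h θbar A (schedDelta δ₀ δ₁ N) fun j => 𝒞 1 j) k)) N η ε (activityNormLE (abkmNormParams L N Mord R pT r₀ h θbar A (schedDelta δ₀ δ₁ N) fun j => 𝒞 1 j)) (Ssys x₂)
      (initAct (N := N) (Mord := Mord) (R := R) (p := pT) (r₀ := r₀) (θbar := θbar) (A := A) (δ₀ := δ₀)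
            (δ₁ := δ₁) (𝒞 := fun j => 𝒞 1 j) 𝒦₂ x₂) xx₂)
    (hx₂ : xx₂ 0 = x₂)
    -- the two sizes
    {T B : ℝ} (hdT : ‖x₁ - x₂‖ ≤ T)
    (hDB : ‖Φ x₁ (RGFlow.fwd (Ssys x₁) (initAct (N := N) (Mord := Mord) (R := R) (p := pT) (r₀ := r₀) (θbar := θbar) (A := A) (δ₀ := δ₀)
            (δ₁ := δ₁) (𝒞 := fun j => 𝒞 1 j) 𝒦₁ x₁) xx₁ N)
        - Φ x₂ (RGFlow.fwd (Ssys x₂) (initAct (N := N) (Mord := Mord) (R := R) (p := pT) (r₀ := r₀) (θbar := θbar) (A := A) (δ₀ := δ₀)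
            (δ₁ := δ₁) (𝒞 := fun j => 𝒞 1 j) 𝒦₂ x₂) xx₂ N)‖ ≤ B) :
    ‖(((((Real.log (formChangeConst (M := M) (1 : Matrix (Fin d) (Fin d) ℝ)
              (1 + hamQuadForm (HamSpace.toHam x₁)))) : ℝ) : ℂ)
          + (Fintype.card (Fin d → ZMod M) : ℂ) * (HamSpace.toHam x₁) (Sum.inl ())
          + Complex.log (∫ φ, pcirc 1 (fun V => expNegH (HamSpace.toHam x₁) V φ)
            (fun U => initKH 𝒦₁ (HamSpace.toHam x₁) U φ) Finset.univ
          ∂(tailMeasure (fun jj => 𝒞 ((1 : Matrix (Fin d) (Fin d) ℝ) + hamQuadForm (HamSpace.toHam x₁)) jj) N N))))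
      - (((((Real.log (formChangeConst (M := M) (1 : Matrix (Fin d) (Fin d) ℝ)
              (1 + hamQuadForm (HamSpace.toHam x₂)))) : ℝ) : ℂ)
          + (Fintype.card (Fin d → ZMod M) : ℂ) * (HamSpace.toHam x₂) (Sum.inl ())
          + Complex.log (∫ φ, pcirc 1 (fun V => expNegH (HamSpace.toHam x₂) V φ)
            (fun U => initKH 𝒦₂ (HamSpace.toHam x₂) U φ) Finset.univ
          ∂(tailMeasure (fun jj => 𝒞 ((1 : Matrix (Fin d) (Fin d) ℝ) + hamQuadForm (HamSpace.toHam x₂)) jj) N N))))‖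
    ≤ (Fintype.card (Fin d → ZMod M) : ℝ) * ((2 * (d : ℝ) ^ 2 / (((L ^ (d * 0) : ℕ) : ℝ) * (fieldWt h (L : ℝ) d 0 / (L : ℝ) ^ 0) ^ 2)) * T) + (Fintype.card (Fin d → ZMod M) : ℝ) * T + 1 / (1 - (ε * η ^ N * A⁻¹ * A𝒫')) * B := by
  subst hAsys hBsys hSsys hΦ
  have hh : 0 < h := Fact.out
  have hd2 : 2 ≤ d := by omega
  have hA : 0 < A := by linarith
  have hA𝒫0 : 0 ≤ A𝒫' := by
    rw [← hA𝒫']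
    exact zero_le_one.trans (one_le_weightIntConstRho hθbar hθ0 hθ
      (traceConst_nonneg d Mord R hlam.le (derivSum_nonneg d n _)))
  -- the seeds lie in the `ε`-ball
  have hx₁ε : ‖x₁‖ ≤ ε := by
    have h0 := (htu₁ 0 (Nat.zero_le _)).1
    rw [pow_zero, mul_one, hx₁] at h0
    exact h0
  have hx₂ε : ‖x₂‖ ≤ ε := by
    have h0 := (htu₂ 0 (Nat.zero_le _)).1
    rw [pow_zero, mul_one, hx₂] at h0
    exact h0
  -- the last-scale integrals: identity and bound
  have hI₁ := integral_flowStart_eq_one_add_lastScaleInt hd hMord hMR hLodd hL hR2 hM hθbar hlam hn hn2 hnñ hc hC1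
      hallA hB hp hpM hr₀ hδ₀ hδ₁ hh0 hh2 hθ0 hθ hT₀ hKT₀ hA𝒫' hA1 hA𝒫A hsmall hr hv hωA hc3A hc2A hη hη1 hε hεr hερ
      hρ16 h𝒦₁ h𝒦₁b h𝒦small hp4 hqT₀ (hx₁ε.trans hερ) htr₁ htu₁ hx₁
  have hI₂ := integral_flowStart_eq_one_add_lastScaleInt hd hMord hMR hLodd hL hR2 hM hθbar hlam hn hn2 hnñ hc hC1
      hallA hB hp hpM hr₀ hδ₀ hδ₁ hh0 hh2 hθ0 hθ hT₀ hKT₀ hA𝒫' hA1 hA𝒫A hsmall hr hv hωA hc3A hc2A hη hη1 hε hεr hερ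
      hρ16 h𝒦₂ h𝒦₂b h𝒦small hp4 hqT₀ (hx₂ε.trans hερ) htr₂ htu₂ hx₂
  -- the radius `R₀ = εη^N A⁻¹A_𝒫 < 1`
  have h0AA : 0 ≤ A⁻¹ * A𝒫' := mul_nonneg (inv_pos.2 hA).le hA𝒫0
  have hx1 : ε * η ^ N * A⁻¹ * A𝒫' ≤ ε := by
    have hηN : η ^ N ≤ 1 := pow_le_one₀ hη.le hη1
    have hAA : A⁻¹ * A𝒫' ≤ 1 := by rw [inv_mul_le_iff₀ hA]; linarith
    calc ε * η ^ N * A⁻¹ * A𝒫' = ε * (η ^ N * (A⁻¹ * A𝒫')) := by ring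
      _ ≤ ε * (1 * 1) := by gcongr
      _ = ε := by ring
  have hR₀ : ε * η ^ N * A⁻¹ * A𝒫' < 1 := by linarith
  -- the seeds are small for the form-change calculus
  have hcq0 : 0 ≤ (2 * (d : ℝ) ^ 2 / (((L ^ (d * 0) : ℕ) : ℝ) * (fieldWt h (L : ℝ) d 0 / (L : ℝ) ^ 0) ^ 2)) := by
    have : 0 < fieldWt h (L : ℝ) d 0 := Fact.out
    positivity
  have hh₁ : (2 * (d : ℝ) ^ 2 / (((L ^ (d * 0) : ℕ) : ℝ) * (fieldWt h (L : ℝ) d 0 / (L : ℝ) ^ 0) ^ 2)) * ‖x₁‖ ≤ 1 / 2 := (mul_le_mul_of_nonneg_left hx₁ε hcq0).trans hqε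
  have hh₂ : (2 * (d : ℝ) ^ 2 / (((L ^ (d * 0) : ℕ) : ℝ) * (fieldWt h (L : ℝ) d 0 / (L : ℝ) ^ 0) ^ 2)) * ‖x₂‖ ≤ 1 / 2 := (mul_le_mul_of_nonneg_left hx₂ε hcq0).trans hqε
  -- the algebra of the three pieces
  have hP := norm_freeEnergyPiece_sub_le (M := M) hR₀ x₁ x₂
    (∫ φ, pcirc 1 (fun V => expNegH (HamSpace.toHam x₁) V φ)
            (fun U => initKH 𝒦₁ (HamSpace.toHam x₁) U φ) Finset.univ
          ∂(tailMeasure (fun jj => 𝒞 ((1 : Matrix (Fin d) (Fin d) ℝ) + hamQuadForm (HamSpace.toHam x₁)) jj) N N))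
    (∫ φ, pcirc 1 (fun V => expNegH (HamSpace.toHam x₂) V φ)
            (fun U => initKH 𝒦₂ (HamSpace.toHam x₂) U φ) Finset.univ
          ∂(tailMeasure (fun jj => 𝒞 ((1 : Matrix (Fin d) (Fin d) ℝ) + hamQuadForm (HamSpace.toHam x₂)) jj) N N))
    hh₁ hh₂ hI₁.2 hI₂.2
  -- the `I`-difference is a `Φ`-difference
  have hBB : ‖(∫ φ, pcirc 1 (fun V => expNegH (HamSpace.toHam x₁) V φ)
            (fun U => initKH 𝒦₁ (HamSpace.toHam x₁) U φ) Finset.univ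
          ∂(tailMeasure (fun jj => 𝒞 ((1 : Matrix (Fin d) (Fin d) ℝ) + hamQuadForm (HamSpace.toHam x₁)) jj) N N)) - (∫ φ, pcirc 1 (fun V => expNegH (HamSpace.toHam x₂) V φ)
            (fun U => initKH 𝒦₂ (HamSpace.toHam x₂) U φ) Finset.univ
          ∂(tailMeasure (fun jj => 𝒞 ((1 : Matrix (Fin d) (Fin d) ℝ) + hamQuadForm (HamSpace.toHam x₂)) jj) N N))‖ ≤ B := by
    rw [hI₁.1, hI₂.1, add_sub_add_left_eq_sub]; exact hDB
  -- monotonicity of the three terms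
  have hV0 : 0 ≤ (Fintype.card (Fin d → ZMod M) : ℝ) := by positivity
  have hK0 : 0 < 1 - ε * η ^ N * A⁻¹ * A𝒫' := by linarith
  have t1 : (Fintype.card (Fin d → ZMod M) : ℝ) * ((2 * (d : ℝ) ^ 2 / (((L ^ (d * 0) : ℕ) : ℝ) * (fieldWt h (L : ℝ) d 0 / (L : ℝ) ^ 0) ^ 2)) * ‖x₁ - x₂‖) ≤ (Fintype.card (Fin d → ZMod M) : ℝ) * ((2 * (d : ℝ) ^ 2 / (((L ^ (d * 0) : ℕ) : ℝ) * (fieldWt h (L : ℝ) d 0 / (L : ℝ) ^ 0) ^ 2)) * T) :=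
    mul_le_mul_of_nonneg_left (mul_le_mul_of_nonneg_left hdT hcq0) hV0
  have t3 : (Fintype.card (Fin d → ZMod M) : ℝ) * ‖x₁ - x₂‖ ≤ (Fintype.card (Fin d → ZMod M) : ℝ) * T := mul_le_mul_of_nonneg_left hdT hV0
  have t4 : 1 / (1 - ε * η ^ N * A⁻¹ * A𝒫') * ‖(∫ φ, pcirc 1 (fun V => expNegH (HamSpace.toHam x₁) V φ)
            (fun U => initKH 𝒦₁ (HamSpace.toHam x₁) U φ) Finset.univ
          ∂(tailMeasure (fun jj => 𝒞 ((1 : Matrix (Fin d) (Fin d) ℝ) + hamQuadForm (HamSpace.toHam x₁)) jj) N N)) - (∫ φ, pcirc 1 (fun V => expNegH (HamSpace.toHam x₂) V φ)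
            (fun U => initKH 𝒦₂ (HamSpace.toHam x₂) U φ) Finset.univ
          ∂(tailMeasure (fun jj => 𝒞 ((1 : Matrix (Fin d) (Fin d) ℝ) + hamQuadForm (HamSpace.toHam x₂)) jj) N N))‖
      ≤ 1 / (1 - ε * η ^ N * A⁻¹ * A𝒫') * B :=
    mul_le_mul_of_nonneg_left hBB (div_pos one_pos hK0).le
  exact hP.trans (by linarith [t1, t3, t4])

end Package

end Summit.HubbardSuperconductivity.HubbardSuperconductivity.Theorems.ComplexGFF

end
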